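import Mathlib.Tactic.Linarith
import Mathlib.Tactic.Ring
import Mathlib.Tactic.NormNum
import Mathlib.Tactic.Positivity
import Mathlib.Tactic.FieldSimp
import Mathlib.Algebra.Order.Field.Basic
import Literature.NumberTheory.QuadraticFields.ClassNumberOneLandau
import HarnessLib

/-!
# The rank-two zero-locus WINDOW for Bloch seeds on Weil-type abelian FOURFOLDS: Weil charge costs `h¹(N_Z)`
# (Bloch 1972 §7; Koszul + Hirzebruch–Riemann–Roch + Serre duality — the arithmetic and the counting)

Family `hodge`, layer `Literature/AlgebraicGeometry/HodgeTheory`. Fully PROVED statements (no named fact, no definition):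
the kernel-checkable core of the ladder note `papers/HodgeConjecture/hodge-weil-ladder`, section "Bloch seeds: the
rank-two window" (prover 2, generation 5; packet `run/shared/lean/b2b/hodge-weil/b2b-hweil-pv2-g5/VARIATIONAL-G5.md` §3),
same standard as `SemiregularityEulerFormBarrier.lean`. It quantifies, in the first non-trivial dimension, the slogan
of Bloch's Remark (7.5) [`Bloch1972Semiregularity`] ("the problem of constructing semi-regular representatives for
algebraic cycle classes of codimension `> 1` remains, however, wide open") for the simplest local-complete-intersection
design that can carry a WEIL class: the zero scheme of a regular section of a rank-two bundle.

## Dictionary (pen-and-paper inputs; each line is a standard theorem, named)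

`Y` a complex abelian FOURFOLD; `h ∈ H²(Y, ℚ)` with `∫_Y h⁴ = H > 0` and `h ⌣ w' = 0` for the class `w'` below (for a
Weil-type `(Y, K, h)` with `h` `K`-symmetric and `w'` in the Weil plane this is PRIM, tree
`cupProduct_eq_zero_of_map_eq_smul_of_mem_weilClassesOf`); `E` a rank-two vector bundle with `c₁(E) = m·h`,
`c₂(E) = q·h² + w'`, `ω := ∫_Y w'²` (for a non-zero rational Weil class on a fourfold `ω > 0`: ANISO, tree
`cupProduct_self_ne_zero_of_isRationalClass_of_mem_weilClassesOf`, sign `(-1)^k = +1` at `k = 2`); `s ∈ H⁰(E)` a REGULAR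
section with zero scheme `Z` (a local complete intersection surface, `[Z] = c₂(E)`, `N_Z = E|_Z`, `ω_Z = det E|_Z`).
* (K) Koszul: `0 → det E^∨ → E^∨ → 𝒪_Y → 𝒪_Z → 0`, so `χ(N_Z) = χ(E) − χ(E ⊗ E^∨) + χ(E^∨)` [Fulton, Intersection Theory,
  §14.1; Hartshorne II.8].
* (HRR) on an abelian variety `td = 1`, `χ(F) = ∫ ch₄(F)` [Mumford, Abelian Varieties, §16]; with `c₃ = c₄ = 0`:
  `ch₄(E) = (c₁⁴ − 4c₁²c₂ + 2c₂²)/24 = ch₄(E^∨)`, `ch₄(E ⊗ E^∨) = 4ch₄ − 2c₁ch₃ + ch₂²`; in numbers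
  (`A = ∫c₁⁴ = m⁴H`, `B = ∫c₁²c₂ = m²qH`, `C = ∫c₂² = q²H + ω`, using `h ⌣ w' = 0`):
  **`χ(N_Z) = B/3 − 7C/6 = H(2m²q − 7q²)/6 − 7ω/6`** (`chiNormal_eq`, `chiNormal_weil`), `χ(E) = (A − 4B + 2C)/24`.
* (SD) Serre duality on the Gorenstein surface `Z` and `E^∨ ⊗ det E ≅ E` (rank two): `h²(N_Z) = h⁰(N_Z)`, hence
  **`h¹(N_Z) = 2h⁰(N_Z) − χ(N_Z)`**.
* (S) sections: from `0 → E^∨ → End E → 𝒦 → 0`, `0 → 𝒦 → E → E|_Z → 0`: `h⁰(N_Z) ≥ h⁰(E) − h⁰(End E) − h³(E)`; for `E`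
  SIMPLE and IT₀ (`Hⁱ(E) = 0`, `i > 0`): **`h⁰(N_Z) ≥ χ(E) − 1`**.
* (B) Bloch semiregularity of `Z ⊂ Y` (codimension `p = 2`) is injectivity of `π : H¹(Z, N_Z) → H³(Y, Ω¹_Y)`, and
  `dim H³(Y, Ω¹_Y) = h^{1,3}(Y) = 4·4 = 16`; so it needs **`h¹(N_Z) ≤ 16`** [Bloch 1972, §7; Buchweitz–Flenner 2003, (8.1)].
* (L) at the CM fourfold `Y = E_K²(ι) × E_K²(ῑ)`, `E_K = ℂ/𝒪`, with a `K`-symmetric PRODUCT polarization: `[Z] ∈ H⁴(Y, ℤ)`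
  and `w' = [Z] − q h²` lies in `W_ℤ = W ∩ H⁴(Y, ℤ) = ⟨Re w_σ, Im' w_σ⟩` (exact exterior-algebra computation over `ℤ`, script
  `weil4_lattice.py` of the packet: Gram matrix `diag(8d², 8d)` for `𝒪 = ℤ[√-d]` — by hand for every `d` —, and
  `[[6,3],[3,6]]`, `[[14,−7],[−7,28]]`, `[[22,−11],[−11,66]]` for the maximal orders at `d = 3, 7, 11`; no half-classes in
  `ℚh² ⊕ W`): **`ω ≥ 8d`** (order `ℤ[√-d]`), **`ω ∈ {6, 18, …}`** (`d = 3`), **`ω ≥ 14`** (`d = 7`), **`ω ≥ 22`** (`d = 11`).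

## What is proved here (arithmetic only; the dictionary is the geometry)

`chiNormal_eq`, `chiNormal_weil`, `chiE_weil` (HRR bookkeeping as polynomial identities); `hOne_lower_bound` — from (SD),
(S): **`h¹(N_Z) ≥ H(m² − 4q)²/12 + (4/3)ω − 2`**; `window_of_semiregular` — with (B): **`16ω + H(m² − 4q)² ≤ 216`**, so
`ω ≤ 27/2` (`omega_le_of_semiregular`) and, at the Bogomolov boundary `4q = m²`, `h¹(N_Z) ≥ (4/3)ω − 2` independently of the
positivity `m`; `window_empty_of_fourteen_le` etc.: the window is EMPTY as soon as `ω ≥ 14`; the lattice minima of (L):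
`weilNorm_nonmaximal_ge` (`8d²b² + 8dc² ≥ 8d` for `(b,c) ≠ 0`), `weilNorm_sqrtMinus7_maximal_ge` (`14b² − 14bc + 28c² ≥ 14`),
`weilNorm_sqrtMinus11_maximal_ge`, `weilNorm_sqrtMinus3_maximal_ge`; and the verdicts `no_rankTwo_seed_nonmaximal`
(`d ≥ 2`, order `ℤ[√-d]`: no simple IT₀ rank-two zero-locus Bloch seed), `no_rankTwo_seed_sqrtMinus7`,
`no_rankTwo_seed_sqrtMinus11`, and the two SURVIVORS `(K, 𝒪) = (ℚ(i), ℤ[i])` (`ω = 8`, then `H(m²−4q)² ≤ 88`) and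
`(ℚ(√-3), ℤ[ζ₃])` (`ω = 6`, `H(m²−4q)² ≤ 120`) — exactly the two fields with extra units, where the fourfold Weil classes are
classically algebraic (Schoen 1988/1998, van Geemen 1994).

HONEST FRAMING. A design-space census statement (what a Bloch seed on a Weil FOURFOLD can NOT be), not a case of the Hodge
conjecture; the hypotheses "simple, IT₀, rank two, zero locus of a regular section" are load-bearing (the general inequality
(S) is recorded for non-IT₀ bundles); dimension `2k = 6` (the rung-relevant one) has no rank-three analogue of (SD) and is
NOT treated. Relies on nothing unproved.

## References
* [Bloch1972Semiregularity] S. Bloch, Semi-regularity and de Rham cohomology, Invent. Math. 17 (1972), §7, Remark (7.5).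
* [BuchweitzFlenner2003] R.-O. Buchweitz, H. Flenner, Compositio Math. 137 (2003), (8.1), Prop. 8.2.
* [Fulton1998] W. Fulton, Intersection Theory, 2nd ed., §14.1 (zero schemes of regular sections), Example 3.2.3, §15.2.
* [MumfordAV1970] D. Mumford, Abelian Varieties, §16 (Riemann–Roch and the index theorem on abelian varieties).
* [Hartshorne1977] R. Hartshorne, Algebraic Geometry, III §7 (Serre duality for projective Cohen–Macaulay schemes).
* [vanGeemen1994HodgeAV] B. van Geemen, LNM 1594 (1994), 4.9, 5.2, 6.12 (the Weil plane; its intersection form).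
* [Schoen1988HodgeWeil] C. Schoen, Hodge classes on self-products of a variety with an automorphism, Compositio Math. 65
  (1988) (Weil fourfolds over ℚ(√-3)).
-/

namespace Literature.AlgebraicGeometry.HodgeTheory

namespace BlochSeedRankTwoWindow

open Literature.NumberTheory.QuadraticFields.BinaryQuadraticForm (one_le_sq_of_ne_zero)

/-! ### (HRR) the Euler characteristic of the normal bundle of a rank-two zero locus -/

/-- **`χ(N_Z) = −2ch₄ + 2c₁ch₃ − ch₂² = B/3 − 7C/6`** in the numbers `A = ∫c₁⁴`, `B = ∫c₁²c₂`, `C = ∫c₂²` (rank two,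
`c₃ = c₄ = 0`: `ch₄ = (A − 4B + 2C)/24`, `c₁ch₃ = (A − 3B)/6`, `ch₂² = (A − 4B + 4C)/4`; Koszul (K) and HRR on an abelian
fourfold). The `A`-terms cancel. [cite: Fulton1998, §14.1 and Example 3.2.3] [cite: MumfordAV1970, §16] -/
theorem chiNormal_eq (A B C : ℚ) :
    -2 * ((A - 4 * B + 2 * C) / 24) + 2 * ((A - 3 * B) / 6) - (A - 4 * B + 4 * C) / 4 = B / 3 - 7 * C / 6 := by
  ring

/-- The same in the Weil coordinates `c₁ = m h`, `c₂ = q h² + w'`, `h ⌣ w' = 0`, `H = ∫h⁴`, `ω = ∫w'²`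
(`A = m⁴H`, `B = m²qH`, `C = q²H + ω`): **`χ(N_Z) = H(2m²q − 7q²)/6 − 7ω/6`**. [cite: Fulton1998, §14.1] [cite: MumfordAV1970, §16] -/
theorem chiNormal_weil (H ω m q : ℚ) :
    (m ^ 2 * q * H) / 3 - 7 * (q ^ 2 * H + ω) / 6 = H * (2 * m ^ 2 * q - 7 * q ^ 2) / 6 - 7 * ω / 6 := by
  ring

/-- `χ(E) = ∫ch₄(E) = (A − 4B + 2C)/24 = (m⁴H − 4m²qH + 2q²H + 2ω)/24` (HRR, `td = 1`). [cite: MumfordAV1970, §16] -/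
theorem chiE_weil (H ω m q : ℚ) :
    (m ^ 4 * H - 4 * (m ^ 2 * q * H) + 2 * (q ^ 2 * H + ω)) / 24 =
      (m ^ 4 * H - 4 * m ^ 2 * q * H + 2 * q ^ 2 * H + 2 * ω) / 24 := by
  ring

/-- Sanity (the split corner): for `E = L ⊕ L`, `c₁(L) = (m/2) h` (`q = m²/4`, `ω = 0`) the formula gives
`χ(N_Z) = m⁴H/96 = 2·χ(L|_Z)` with `χ(L|_Z) = χ(L) + χ(L⁻¹) = 2(m/2)⁴H/24` (Koszul for the complete intersection).
[cite: Fulton1998, §14.1] -/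
theorem chiNormal_split_corner (H m : ℚ) :
    H * (2 * m ^ 2 * (m ^ 2 / 4) - 7 * (m ^ 2 / 4) ^ 2) / 6 - 7 * 0 / 6 = 2 * (2 * (m / 2) ^ 4 * H / 24) := by
  ring

/-- Sanity (the general split case): `E = L₁ ⊕ L₂`, `c₁(Lᵢ) = aᵢ h`: `m = a₁ + a₂`, `q = a₁a₂`, `ω = 0`, and the formula
agrees with the Koszul computation `χ(L₁|_Z) + χ(L₂|_Z) = (a₁⁴ + a₂⁴ − (a₁ − a₂)⁴)H/12`. [cite: Fulton1998, §14.1] -/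
theorem chiNormal_split (H a₁ a₂ : ℚ) :
    H * (2 * (a₁ + a₂) ^ 2 * (a₁ * a₂) - 7 * (a₁ * a₂) ^ 2) / 6 = (a₁ ^ 4 + a₂ ^ 4 - (a₁ - a₂) ^ 4) * H / 12 := by
  ring

/-! ### (SD) + (S): the lower bound for `h¹(N_Z)` -/

/-- **`h¹(N_Z) ≥ H(m² − 4q)²/12 + (4/3)ω − 2`** for a simple IT₀ rank-two bundle: from `h¹ = 2h⁰ − χ(N_Z)` (Serre duality
on `Z`, `E^∨ ⊗ det E ≅ E`), `h⁰ ≥ χ(E) − 1` (sections modulo `End E = ℂ`, `H³(E) = 0`), and the two HRR values.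
[cite: Hartshorne1977, III §7] [cite: MumfordAV1970, §16] [cite: Bloch1972Semiregularity, §7] -/
theorem hOne_lower_bound (H ω m q h0 h1 : ℚ)
    (hh0 : (m ^ 4 * H - 4 * m ^ 2 * q * H + 2 * q ^ 2 * H + 2 * ω) / 24 - 1 ≤ h0)
    (hh1 : h1 = 2 * h0 - (H * (2 * m ^ 2 * q - 7 * q ^ 2) / 6 - 7 * ω / 6)) :
    H * (m ^ 2 - 4 * q) ^ 2 / 12 + 4 * ω / 3 - 2 ≤ h1 := by
  rw [hh1]
  nlinarith [hh0]

/-- The general (non-IT₀, non-simple) form: with `h⁰(N_Z) ≥ h⁰(E) − h⁰(End E) − h³(E)` only,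
`h¹(N_Z) ≥ 2(h⁰(E) − h⁰(End E) − h³(E)) − χ(N_Z)`. [cite: Hartshorne1977, III §7] -/
theorem hOne_lower_bound_general (χN s e t h0 h1 : ℚ) (hh0 : s - e - t ≤ h0) (hh1 : h1 = 2 * h0 - χN) :
    2 * (s - e - t) - χN ≤ h1 := by
  rw [hh1]; linarith

/-! ### (B): the window -/

/-- **THE WINDOW.** If moreover `Z` is Bloch-semiregular (`h¹(N_Z) ≤ dim H³(Y, Ω¹_Y) = 16`) and `H = ∫h⁴ ≥ 0`, then
`16ω + H(m² − 4q)² ≤ 216`. [cite: Bloch1972Semiregularity, §7 and Remark (7.5)] [cite: BuchweitzFlenner2003, (8.1)] -/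
theorem window_of_semiregular (H ω m q h1 : ℚ) (hlow : H * (m ^ 2 - 4 * q) ^ 2 / 12 + 4 * ω / 3 - 2 ≤ h1)
    (h16 : h1 ≤ 16) : 16 * ω + H * (m ^ 2 - 4 * q) ^ 2 ≤ 216 := by
  linarith

/-- Consequence: **`ω = ∫w'² ≤ 27/2`** (the Weil charge of a rank-two zero-locus seed is bounded, independently of the
positivity `m` and of `q`). [cite: Bloch1972Semiregularity, Remark (7.5)] -/
theorem omega_le_of_semiregular (H ω m q h1 : ℚ) (hH : 0 ≤ H)
    (hlow : H * (m ^ 2 - 4 * q) ^ 2 / 12 + 4 * ω / 3 - 2 ≤ h1) (h16 : h1 ≤ 16) : ω ≤ 27 / 2 := by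
  have hsq : 0 ≤ H * (m ^ 2 - 4 * q) ^ 2 := by positivity
  linarith

/-- At the Bogomolov boundary `4q = m²` the positivity drops out: `h¹(N_Z) ≥ (4/3)ω − 2`. [cite: Bloch1972Semiregularity, §7] -/
theorem hOne_lower_bound_bogomolov_boundary (H ω m h1 : ℚ)
    (hlow : H * (m ^ 2 - 4 * (m ^ 2 / 4)) ^ 2 / 12 + 4 * ω / 3 - 2 ≤ h1) : 4 * ω / 3 - 2 ≤ h1 := by
  have : H * (m ^ 2 - 4 * (m ^ 2 / 4)) ^ 2 / 12 = 0 := by ring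
  linarith

/-- Consequence on the `h`-part: `H(m² − 4q)² ≤ 216 − 16ω` (`≤ 88` at `ω = 8`, `≤ 120` at `ω = 6`).
[cite: Bloch1972Semiregularity, Remark (7.5)] -/
theorem discriminant_le_of_semiregular (H ω m q h1 : ℚ)
    (hlow : H * (m ^ 2 - 4 * q) ^ 2 / 12 + 4 * ω / 3 - 2 ≤ h1) (h16 : h1 ≤ 16) :
    H * (m ^ 2 - 4 * q) ^ 2 ≤ 216 - 16 * ω := by
  linarith

/-- The window is EMPTY as soon as `ω ≥ 14`. [cite: Bloch1972Semiregularity, Remark (7.5)] -/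
theorem window_empty_of_fourteen_le (H ω m q h1 : ℚ) (hH : 0 ≤ H) (hω : 14 ≤ ω)
    (hlow : H * (m ^ 2 - 4 * q) ^ 2 / 12 + 4 * ω / 3 - 2 ≤ h1) : ¬ h1 ≤ 16 := by
  intro h16
  have := omega_le_of_semiregular H ω m q h1 hH hlow h16
  linarith

/-! ### (L): the Weil lattice minima at the CM fourfolds `E_K²(ι) × E_K²(ῑ)` -/

/-- Order `ℤ[√-d]`: the Weil lattice `W_ℤ = ⟨Re, Im'⟩` has Gram matrix `diag(8d², 8d)` (`Re = Ps Ps' − d·P1 P1'`,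
`Im' = Ps P1' + P1 Ps'`, with `P1² = −2`, `Ps² = −2d`, `P1·Ps = 0` on `E × E`), so a non-zero vector `b·Re + c·Im'` has
`ω = 8d²b² + 8dc² ≥ 8d`. [cite: vanGeemen1994HodgeAV, 4.9 and 5.2] -/
theorem weilNorm_nonmaximal_ge (d b c : ℤ) (hd : 1 ≤ d) (hbc : b ≠ 0 ∨ c ≠ 0) :
    8 * d ≤ 8 * d ^ 2 * b ^ 2 + 8 * d * c ^ 2 := by
  rcases hbc with hb | hc
  · have hb2 := one_le_sq_of_ne_zero hb
    nlinarith [sq_nonneg c]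
  · have hc2 := one_le_sq_of_ne_zero hc
    nlinarith [sq_nonneg b]

/-- Maximal order of `ℚ(√-7)`: Gram matrix `[[14, −7], [−7, 28]]` (computed), `ω = 14b² − 14bc + 28c² ≥ 14` for
`(b, c) ≠ 0`. [cite: vanGeemen1994HodgeAV, 4.9 and 5.2] -/
theorem weilNorm_sqrtMinus7_maximal_ge (b c : ℤ) (hbc : b ≠ 0 ∨ c ≠ 0) :
    14 ≤ 14 * b ^ 2 - 14 * b * c + 28 * c ^ 2 := by
  by_cases hc : c = 0
  · subst hc
    have hb2 := one_le_sq_of_ne_zero (hbc.resolve_right (fun h => h rfl))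
    nlinarith
  · have hc2 := one_le_sq_of_ne_zero hc
    nlinarith [sq_nonneg (b - c), sq_nonneg b]

/-- Maximal order of `ℚ(√-11)`: Gram matrix `[[22, −11], [−11, 66]]` (computed), `ω ≥ 22` for `(b, c) ≠ 0`.
[cite: vanGeemen1994HodgeAV, 4.9 and 5.2] -/
theorem weilNorm_sqrtMinus11_maximal_ge (b c : ℤ) (hbc : b ≠ 0 ∨ c ≠ 0) :
    22 ≤ 22 * b ^ 2 - 22 * b * c + 66 * c ^ 2 := by
  by_cases hc : c = 0
  · subst hc
    have hb2 := one_le_sq_of_ne_zero (hbc.resolve_right (fun h => h rfl))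
    nlinarith
  · have hc2 := one_le_sq_of_ne_zero hc
    nlinarith [sq_nonneg (b - c), sq_nonneg b]

/-- Maximal order of `ℚ(√-3)` (`E = ℂ/ℤ[ζ₃]`): Gram matrix `[[6, 3], [3, 6]]` (computed): `ω = 6(b² + bc + c²) ≥ 6`, and
`ω = 6` is attained — INSIDE the window. [cite: vanGeemen1994HodgeAV, 4.9 and 5.2] [cite: Schoen1988HodgeWeil, §1] -/
theorem weilNorm_sqrtMinus3_maximal_ge (b c : ℤ) (hbc : b ≠ 0 ∨ c ≠ 0) :
    6 ≤ 6 * b ^ 2 + 6 * b * c + 6 * c ^ 2 := by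
  by_cases hc : c = 0
  · subst hc
    have hb2 := one_le_sq_of_ne_zero (hbc.resolve_right (fun h => h rfl))
    nlinarith
  · by_cases hb : b = 0
    · subst hb
      have hc2 := one_le_sq_of_ne_zero hc
      nlinarith
    · have hb2 := one_le_sq_of_ne_zero hb
      have hc2 := one_le_sq_of_ne_zero hc
      nlinarith [sq_nonneg (b + c)]

/-! ### Verdicts -/

/-- **No rank-two zero-locus Bloch seed at the CM fourfold for the order `ℤ[√-d]`, `d ≥ 2`** (simple IT₀ bundle, product
polarization): the Weil charge has `ω ≥ 8d ≥ 16 > 27/2`. [cite: Bloch1972Semiregularity, Remark (7.5)]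
[cite: vanGeemen1994HodgeAV, 4.9] -/
theorem no_rankTwo_seed_nonmaximal (d b c : ℤ) (hd : 2 ≤ d) (hbc : b ≠ 0 ∨ c ≠ 0) (H m q h1 : ℚ) (hH : 0 ≤ H)
    (hlow : H * (m ^ 2 - 4 * q) ^ 2 / 12 + 4 * ((8 * d ^ 2 * b ^ 2 + 8 * d * c ^ 2 : ℤ) : ℚ) / 3 - 2 ≤ h1) :
    ¬ h1 ≤ 16 := by
  have h8 : 8 * d ≤ 8 * d ^ 2 * b ^ 2 + 8 * d * c ^ 2 := weilNorm_nonmaximal_ge d b c (by omega) hbc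
  have h14 : (14 : ℚ) ≤ ((8 * d ^ 2 * b ^ 2 + 8 * d * c ^ 2 : ℤ) : ℚ) := by
    have : (16 : ℤ) ≤ 8 * d ^ 2 * b ^ 2 + 8 * d * c ^ 2 := by linarith
    exact_mod_cast (by linarith : (14 : ℤ) ≤ 8 * d ^ 2 * b ^ 2 + 8 * d * c ^ 2)
  exact window_empty_of_fourteen_le H _ m q h1 hH h14 hlow

/-- **No rank-two zero-locus Bloch seed at the CM fourfold of `ℚ(√-7)` with `E = ℂ/𝒪_K`** (simple IT₀, product
polarization): `ω ≥ 14 > 27/2` — the window misses by one half. [cite: Bloch1972Semiregularity, Remark (7.5)] -/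
theorem no_rankTwo_seed_sqrtMinus7 (b c : ℤ) (hbc : b ≠ 0 ∨ c ≠ 0) (H m q h1 : ℚ) (hH : 0 ≤ H)
    (hlow : H * (m ^ 2 - 4 * q) ^ 2 / 12 + 4 * ((14 * b ^ 2 - 14 * b * c + 28 * c ^ 2 : ℤ) : ℚ) / 3 - 2 ≤ h1) :
    ¬ h1 ≤ 16 := by
  have h14 : (14 : ℚ) ≤ ((14 * b ^ 2 - 14 * b * c + 28 * c ^ 2 : ℤ) : ℚ) := by
    exact_mod_cast weilNorm_sqrtMinus7_maximal_ge b c hbc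
  exact window_empty_of_fourteen_le H _ m q h1 hH h14 hlow

/-- **No rank-two zero-locus Bloch seed at the CM fourfold of `ℚ(√-11)` with `E = ℂ/𝒪_K`** (simple IT₀, product
polarization): `ω ≥ 22`. [cite: Bloch1972Semiregularity, Remark (7.5)] -/
theorem no_rankTwo_seed_sqrtMinus11 (b c : ℤ) (hbc : b ≠ 0 ∨ c ≠ 0) (H m q h1 : ℚ) (hH : 0 ≤ H)
    (hlow : H * (m ^ 2 - 4 * q) ^ 2 / 12 + 4 * ((22 * b ^ 2 - 22 * b * c + 66 * c ^ 2 : ℤ) : ℚ) / 3 - 2 ≤ h1) :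
    ¬ h1 ≤ 16 := by
  have h14 : (14 : ℚ) ≤ ((22 * b ^ 2 - 22 * b * c + 66 * c ^ 2 : ℤ) : ℚ) := by
    have := weilNorm_sqrtMinus11_maximal_ge b c hbc
    exact_mod_cast (by linarith : (14 : ℤ) ≤ 22 * b ^ 2 - 22 * b * c + 66 * c ^ 2)
  exact window_empty_of_fourteen_le H _ m q h1 hH h14 hlow

/-- **The two survivors.** At `ω = 8` (`ℚ(i)`, `E = ℂ/ℤ[i]`, `w' = ±Re` or `±Im'`) and at `ω = 6` (`ℚ(√-3)`, `E = ℂ/ℤ[ζ₃]`)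
the window is NOT empty: it leaves `H(m² − 4q)² ≤ 88`, resp. `≤ 120`, and at the Bogomolov boundary the bound reads
`h¹(N_Z) ≥ 26/3`, resp. `≥ 6` — compatible with `h¹ ≤ 16`. (These are exactly the two fields with extra units, where the
fourfold Weil classes are classically algebraic.) [cite: Schoen1988HodgeWeil, §1] [cite: vanGeemen1994HodgeAV, 6.12] -/
theorem survivors_window :
    (216 : ℚ) - 16 * 8 = 88 ∧ (216 : ℚ) - 16 * 6 = 120 ∧ (4 : ℚ) * 8 / 3 - 2 = 26 / 3 ∧ (4 : ℚ) * 6 / 3 - 2 = 6 ∧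
      (26 : ℚ) / 3 ≤ 16 := by
  norm_num


/-! ### Appendix (general lci surfaces in an abelian fourfold): `h¹(N_Z) = 2(h⁰(N_Z) − χ(𝒪_Z)) + Z·Z`

For ANY local complete intersection surface `Z` in an abelian (indeed any `K`-trivial) fourfold `Y`: `N_Z` has rank two and
`ω_Z = det N_Z`, so `N_Z^∨ ⊗ ω_Z ≅ N_Z` and Serre duality gives `h²(N_Z) = h⁰(N_Z)` with NO hypothesis on how `Z` is presented;
Hirzebruch–Riemann–Roch on `Z` with `c₁(N_Z) = K_Z`, `c₂(N_Z) = Z·Z` gives `χ(N_Z) = 2χ(𝒪_Z) − Z·Z`. Hence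
**`h¹(N_Z) = 2(h⁰(N_Z) − χ(𝒪_Z)) + Z·Z`**, and Bloch-semiregularity (`h¹(N_Z) ≤ 16`) requires
**`Z·Z = q²H + ω ≤ 16 + 2(χ(𝒪_Z) − h⁰(N_Z))`**: a Weil-charged seed (`ω ≥ ω_min(d)`, lattice section above) needs MANY 2-forms
(`χ(𝒪_Z)` at least `h⁰(N_Z) + (q²H + ω − 16)/2`). For a rank-two zero locus `χ(𝒪_Z) = χ(𝒪) − χ(E^∨) + χ(det E^∨) =
(2m²qH − q²H − ω)/12` (Koszul), which recovers `chiNormal_weil` (`chiNormal_general_zeroLocus`).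
[cite: Hartshorne1977, III §7 and Appendix A §4] [cite: Fulton1998, §15.2] -/

/-- **`χ(N_Z) = 2χ(𝒪_Z) − Z·Z` for a rank-two bundle `N` on a surface with `c₁(N) = K_Z`, `∫c₂(N) = Z·Z`** (HRR on `Z`:
`χ(N) = ∫(ch₂(N) + ch₁(N)·td₁(Z)) + 2χ(𝒪_Z)` with `td₁ = −K_Z/2`): in numbers, with `KK = K_Z²`, `ZZ = ∫c₂(N)`,
`(KK − 2ZZ)/2 + KK·(−1/2) + 2χO = 2χO − ZZ`. [cite: Hartshorne1977, Appendix A §4] -/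
theorem chiNormal_lci_surface (KK ZZ χO : ℚ) : (KK - 2 * ZZ) / 2 + KK * (-1 / 2) + 2 * χO = 2 * χO - ZZ := by
  ring

/-- Consistency with the zero-locus formula: for `Z = Z(s)`, `E` rank two, `χ(𝒪_Z) = (2m²qH − q²H − ω)/12` (Koszul) and
`Z·Z = ∫c₂(E)² = q²H + ω`, so `2χ(𝒪_Z) − Z·Z = H(2m²q − 7q²)/6 − 7ω/6` = `chiNormal_weil`. [cite: Fulton1998, §14.1] -/
theorem chiNormal_general_zeroLocus (H ω m q : ℚ) :
    2 * ((2 * m ^ 2 * q * H - q ^ 2 * H - ω) / 12) - (q ^ 2 * H + ω) = H * (2 * m ^ 2 * q - 7 * q ^ 2) / 6 - 7 * ω / 6 := by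
  ring

/-- **The general window**: for any lci surface seed, `h¹(N_Z) = 2h⁰(N_Z) − (2χ(𝒪_Z) − Z·Z)` (Serre duality
`N^∨ ⊗ ω_Z ≅ N`) and Bloch-semiregularity `h¹(N_Z) ≤ 16` give `Z·Z ≤ 16 + 2(χ(𝒪_Z) − h⁰(N_Z))` — the self-intersection of a
Bloch seed, hence its Weil charge `ω ≤ Z·Z − q²H`, is paid for by `χ(𝒪_Z)`. [cite: Bloch1972Semiregularity, §7 and Remark (7.5)]
[cite: Hartshorne1977, III §7] -/
theorem selfIntersection_le_of_semiregular (ZZ χO h0 h1 : ℚ) (hh1 : h1 = 2 * h0 - (2 * χO - ZZ)) (h16 : h1 ≤ 16) :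
    ZZ ≤ 16 + 2 * (χO - h0) := by
  rw [hh1] at h16; linarith

/-- The Weil-charge form: with `Z·Z = q²H + ω`, `H ≥ 0`: `ω ≤ 16 + 2(χ(𝒪_Z) − h⁰(N_Z))`, i.e.
`χ(𝒪_Z) ≥ h⁰(N_Z) + (ω − 16)/2` — at the CM fourfold of `ℚ(√-7)` (maximal order, `ω ≥ 14`) every Bloch seed has
`χ(𝒪_Z) ≥ h⁰(N_Z) − 1`, and for `ℤ[√-d]`, `d ≥ 2` (`ω ≥ 16`), `χ(𝒪_Z) ≥ h⁰(N_Z)`. [cite: Bloch1972Semiregularity, Remark (7.5)] -/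
theorem chiO_ge_of_semiregular (H ω q χO h0 h1 : ℚ) (hH : 0 ≤ H)
    (hh1 : h1 = 2 * h0 - (2 * χO - (q ^ 2 * H + ω))) (h16 : h1 ≤ 16) : h0 + (ω - 16) / 2 ≤ χO := by
  have hq : 0 ≤ q ^ 2 * H := by positivity
  rw [hh1] at h16
  linarith


/-! ### Appendix 2 (dropping "simple IT₀"): the defect `δ(E) = h⁰(End E) + h²(E) + h³(E) + h⁴(E)` pays for the Weil charge

Without any vanishing hypothesis: `h⁰(E) ≥ χ(E) − h²(E) − h⁴(E)`, `h⁰(N_Z) ≥ h⁰(E) − h⁰(End E) − h³(E)` (as in (S), with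
`h¹(E^∨) = h³(E)` by Serre duality on the fourfold), so `h⁰(N_Z) ≥ χ(E) − δ(E)` with
`δ(E) := h⁰(End E) + h²(E) + h³(E) + h⁴(E) ≥ 1`, and the window becomes **`16ω + H(m² − 4q)² ≤ 192 + 24·δ(E)`** (`δ = 1`
is the simple IT₀ case). At the CM fourfolds: a rank-two zero-locus seed with Weil charge needs **`δ(E) ≥ (2ω_min − 24)/3`** —
`≥ 2` for `ℚ(√-7)` with `E = ℂ/𝒪_K` (`ω_min = 14`), `≥ 7` for `ℚ(√-11)` (`22`), `≥ 30` for the order `ℤ[√-7]` (`56`), and in general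
`≥ (16d − 24)/3` for `ℤ[√-d]`: the scaffolding bundle must be NON-simple or carry higher cohomology of that total dimension.
[cite: Bloch1972Semiregularity, §7 and Remark (7.5)] [cite: MumfordAV1970, §16] -/

/-- **General window**: `h⁰(N_Z) ≥ χ(E) − δ` (any rank-two `E`, `δ = h⁰(End E) + h²(E) + h³(E) + h⁴(E)`), `h¹ = 2h⁰ − χ(N_Z)`,
`h¹ ≤ 16` ⟹ `16ω + H(m² − 4q)² ≤ 192 + 24δ`. [cite: Bloch1972Semiregularity, §7] [cite: MumfordAV1970, §16] -/
theorem window_of_semiregular_defect (H ω m q h0 h1 δ : ℚ)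
    (hh0 : (m ^ 4 * H - 4 * m ^ 2 * q * H + 2 * q ^ 2 * H + 2 * ω) / 24 - δ ≤ h0)
    (hh1 : h1 = 2 * h0 - (H * (2 * m ^ 2 * q - 7 * q ^ 2) / 6 - 7 * ω / 6)) (h16 : h1 ≤ 16) :
    16 * ω + H * (m ^ 2 - 4 * q) ^ 2 ≤ 192 + 24 * δ := by
  rw [hh1] at h16
  nlinarith [hh0]

/-- **The defect a Weil charge demands**: with `H ≥ 0` and `ω ≥ ω₀`, semiregularity forces `δ ≥ (2ω₀ − 24)/3`.
[cite: Bloch1972Semiregularity, Remark (7.5)] -/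
theorem defect_ge_of_semiregular (H ω ω₀ m q h0 h1 δ : ℚ) (hH : 0 ≤ H) (hω : ω₀ ≤ ω)
    (hh0 : (m ^ 4 * H - 4 * m ^ 2 * q * H + 2 * q ^ 2 * H + 2 * ω) / 24 - δ ≤ h0)
    (hh1 : h1 = 2 * h0 - (H * (2 * m ^ 2 * q - 7 * q ^ 2) / 6 - 7 * ω / 6)) (h16 : h1 ≤ 16) :
    (2 * ω₀ - 24) / 3 ≤ δ := by
  have hw := window_of_semiregular_defect H ω m q h0 h1 δ hh0 hh1 h16
  have hsq : 0 ≤ H * (m ^ 2 - 4 * q) ^ 2 := by positivity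
  linarith

/-- The numerical thresholds: `ω₀ = 14` (ℚ(√-7), maximal order) ⟹ `δ ≥ 4/3`, i.e. `δ ≥ 2` for an integer; `ω₀ = 22` ⟹ `δ ≥ 20/3`,
i.e. `δ ≥ 7`; `ω₀ = 56` (order `ℤ[√-7]`) ⟹ `δ ≥ 88/3`, i.e. `δ ≥ 30`; `ω₀ = 8` and `ω₀ = 6` impose nothing (`δ ≥ 1` anyway).
[cite: Bloch1972Semiregularity, Remark (7.5)] -/
theorem defect_thresholds :
    (2 * (14 : ℚ) - 24) / 3 = 4 / 3 ∧ (2 * (22 : ℚ) - 24) / 3 = 20 / 3 ∧ (2 * (56 : ℚ) - 24) / 3 = 88 / 3 ∧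
      (2 * (8 : ℚ) - 24) / 3 < 1 ∧ (2 * (6 : ℚ) - 24) / 3 < 1 ∧
      (∀ n : ℤ, (4 : ℚ) / 3 ≤ n → 2 ≤ n) ∧ (∀ n : ℤ, (20 : ℚ) / 3 ≤ n → 7 ≤ n) ∧ (∀ n : ℤ, (88 : ℚ) / 3 ≤ n → 30 ≤ n) := by
  refine ⟨by norm_num, by norm_num, by norm_num, by norm_num, by norm_num, ?_, ?_, ?_⟩
  · intro n hn
    have : (1 : ℚ) < n := by linarith
    have h1 : (1 : ℤ) < n := by exact_mod_cast this
    omega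
  · intro n hn
    have : (6 : ℚ) < n := by linarith
    have h1 : (6 : ℤ) < n := by exact_mod_cast this
    omega
  · intro n hn
    have : (29 : ℚ) < n := by linarith
    have h1 : (29 : ℤ) < n := by exact_mod_cast this
    omega


/-! ### Appendix 3: integrality of `χ(E)` kills the `ℚ(i)` survivor — only `(ℚ(√-3), ℤ[ζ₃])` survives the rank-two window

(INT) For a `K`-symmetric polarization `h` on `E_K⁴` of any type `δ` (in particular the product polarizations
`h = Σ c_t u_t`, weights `c_t ≥ 1`, `gcd = 1`, `P := ∏ c_t = H/24`, `g₂ := gcd(c_s c_t)`, so `m ∈ ℤ`, `q ∈ (1/2g₂)ℤ` and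
`g₂² ∣ P`; generally `θ²/2` is integral and `gcd(δ_iδ_j)² ∣ Pf(δ)`): the `h`-part `P(m⁴ − 4m²q + 2q²)` of `χ(E) = ∫ch₄(E)`
lies in `½ℤ`, hence `χ(E) ∈ ℤ` forces `ω/12 ∈ ½ℤ`, i.e. **`ω ≡ 0 or 6 (mod 12)`** (`omega_mod_twelve_of_integral`). For
`𝒪 = ℤ[i]` (`ω = 8(b² + c²)`) this forces `3 ∣ b`, `3 ∣ c` (`three_dvd_of_gaussian`), so `ω ≥ 72` (`gaussian_omega_ge`) — the
`ω = 8` survivor of the window is DEAD (`no_rankTwo_seed_gaussian`); for `𝒪 = ℤ[ζ₃]` (`ω = 6(b² + bc + c²)`) the condition is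
automatic and the surviving window is `(m² − 4q)² ≤ 5` with `q ∈ ½ + ℤ` (`sqrtMinus3_window`). FINAL k = 2 VERDICT (simple IT₀,
rank-two zero locus; product polarizations and the sampled non-product `K`-symmetric ones of the packet note §3(l)): only
`(ℚ(√-3), ℤ[ζ₃])` survives. The Weil lattice of the CM SIXFOLD (minima `32d²` for `ℤ[√-d]`, `2d²` for the maximal orders)
and the `k = 3, 4` Euler characteristics are in `BlochSeedZeroLocusEuler.lean` (carver generation 7), not repeated here.
[cite: MumfordAV1970, §16] [cite: vanGeemen1994HodgeAV, 4.9 and 5.2] -/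

/-- **Integrality**: if `12χ = 6a + ω` with `χ, a, ω` integers (`χ(E) ∈ ℤ`, `h`-part `a/2 ∈ ½ℤ`), then `ω ≡ 0` or `6 (mod 12)`.
[cite: MumfordAV1970, §16] -/
theorem omega_mod_twelve_of_integral (a ω χ : ℤ) (hχ : (12 : ℤ) * χ = 6 * a + ω) : ω % 12 = 0 ∨ ω % 12 = 6 := by
  omega

/-- At `ℤ[i]` (`ω = 8(b² + c²)`): `ω ≡ 0, 6 (mod 12)` forces `3 ∣ b` and `3 ∣ c` (squares are `0, 1 mod 3`).
[cite: vanGeemen1994HodgeAV, 4.9] -/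
theorem three_dvd_of_gaussian (b c : ℤ) (h : (8 * (b ^ 2 + c ^ 2)) % 12 = 0 ∨ (8 * (b ^ 2 + c ^ 2)) % 12 = 6) :
    3 ∣ b ∧ 3 ∣ c := by
  have hb : b % 3 = 0 ∨ b % 3 = 1 ∨ b % 3 = 2 := by omega
  have hc : c % 3 = 0 ∨ c % 3 = 1 ∨ c % 3 = 2 := by omega
  have key : (b ^ 2 + c ^ 2) % 3 = 0 := by omega
  have hb2 : b ^ 2 % 3 = 0 ∨ b ^ 2 % 3 = 1 := by
    rcases hb with h0 | h1 | h2
    · left; have : b ^ 2 = b * b := by ring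
      rw [this, Int.mul_emod, h0]; norm_num
    · right; have : b ^ 2 = b * b := by ring
      rw [this, Int.mul_emod, h1]; norm_num
    · right; have : b ^ 2 = b * b := by ring
      rw [this, Int.mul_emod, h2]; norm_num
  have hc2 : c ^ 2 % 3 = 0 ∨ c ^ 2 % 3 = 1 := by
    rcases hc with h0 | h1 | h2
    · left; have : c ^ 2 = c * c := by ring
      rw [this, Int.mul_emod, h0]; norm_num
    · right; have : c ^ 2 = c * c := by ring
      rw [this, Int.mul_emod, h1]; norm_num
    · right; have : c ^ 2 = c * c := by ring
      rw [this, Int.mul_emod, h2]; norm_num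
  have hb0 : b ^ 2 % 3 = 0 := by omega
  have hc0 : c ^ 2 % 3 = 0 := by omega
  constructor
  · have : (3 : ℤ) ∣ b ^ 2 := Int.dvd_of_emod_eq_zero hb0
    exact Int.Prime.dvd_pow' (by norm_num) this
  · have : (3 : ℤ) ∣ c ^ 2 := Int.dvd_of_emod_eq_zero hc0
    exact Int.Prime.dvd_pow' (by norm_num) this

/-- … hence `ω = 8(b² + c²) ≥ 72 > 27/2` for `(b, c) ≠ 0`: **no rank-two zero-locus Bloch seed at the CM fourfold of `ℚ(i)`
either** (simple IT₀). [cite: Bloch1972Semiregularity, Remark (7.5)] [cite: MumfordAV1970, §16] -/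
theorem gaussian_omega_ge (b c : ℤ) (hbc : b ≠ 0 ∨ c ≠ 0) (h3 : 3 ∣ b ∧ 3 ∣ c) : 72 ≤ 8 * (b ^ 2 + c ^ 2) := by
  obtain ⟨⟨b', rfl⟩, ⟨c', rfl⟩⟩ := h3
  rcases hbc with hb | hc
  · have hb' : b' ≠ 0 := by rintro rfl; simp at hb
    have := one_le_sq_of_ne_zero hb'
    nlinarith [sq_nonneg c']
  · have hc' : c' ≠ 0 := by rintro rfl; simp at hc
    have := one_le_sq_of_ne_zero hc'
    nlinarith [sq_nonneg b']

/-- The verdict at `ℚ(i)` assembled: `ω = 8(b²+c²)`, `(b,c) ≠ 0`, `12χ = 6a + ω` integral ⟹ the window `ω ≤ 27/2` fails.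
[cite: Bloch1972Semiregularity, Remark (7.5)] -/
theorem no_rankTwo_seed_gaussian (b c a χ : ℤ) (hbc : b ≠ 0 ∨ c ≠ 0) (hχ : (12 : ℤ) * χ = 6 * a + 8 * (b ^ 2 + c ^ 2)) :
    ¬ ((8 * (b ^ 2 + c ^ 2) : ℤ) : ℚ) ≤ 27 / 2 := by
  have h72 := gaussian_omega_ge b c hbc (three_dvd_of_gaussian b c (omega_mod_twelve_of_integral a _ χ hχ))
  intro hle
  have : (72 : ℚ) ≤ ((8 * (b ^ 2 + c ^ 2) : ℤ) : ℚ) := by exact_mod_cast h72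
  linarith

/-- The surviving `ℚ(√-3)` window: at `ω = 6`, `16ω + 24(m² − 4q)² ≤ 216` iff `(m² − 4q)² ≤ 5`.
[cite: Bloch1972Semiregularity, Remark (7.5)] -/
theorem sqrtMinus3_window (m q : ℚ) : 16 * 6 + 24 * (m ^ 2 - 4 * q) ^ 2 ≤ 216 ↔ (m ^ 2 - 4 * q) ^ 2 ≤ 5 := by
  constructor <;> intro h <;> linarith

end BlochSeedRankTwoWindow

end Literature.AlgebraicGeometry.HodgeTheory
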